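import Summits.NavierStokesRegularity.NavierStokesRegularity.Theorems.PlaneEnergyCeilingPlanarEnergyLiouvilleOfNoLocalTypeI
import Summits.NavierStokesRegularity.NavierStokesRegularity.Theorems.PlaneEnergyCeilingBoundedPlanarEnergyRegularityOfLiouville
import HarnessLib

/-!
# Route PlaneEnergyCeiling · crux `BoundedPlanarEnergyRegularity` (stmt-NavierStokesRegularity-16921)
# ⇐ the Morrey–Liouville statement (L_M) ⇐ no local Type I singularity

Theorems file for the crux item stmt-NavierStokesRegularity-16921
(`Theses.PlaneEnergyCeiling.BoundedPlanarEnergyRegularity`, the (A)-form of the large-norm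
anisotropic `p = ∞` Ladyzhenskaya–Prodi–Serrin endpoint). The landed glue
`BoundedPlanarEnergyRegularity.boundedPlanarEnergyRegularity_of_liouville` reduces the crux to
`PlanarEnergyLiouville`; composed with `planarEnergyLiouville_of_liouvilleMorrey` /
`planarEnergyLiouville_of_not_localTypeISingularityExists` this gives two CONDITIONAL proofs of the
crux: from the Liouville conjecture restricted to Albritton–Barker's Type-I (Morrey) class, and from
the absence of local Type I singular points of suitable weak solutions (Albritton–Barker 2019,
Thm 1.1, first bullet).

## References

* D. Albritton, T. Barker, J. Math. Fluid Mech. 21 (2019) = arXiv:1811.00502, Thm 1.1.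
  [AlbrittonBarker2019]
* G. Koch, N. Nadirashvili, G. Seregin, V. Šverák, Acta Math. 203 (2009) = arXiv:0709.3599, §1,
  Lemma 6.1. [KochNadirashviliSereginSverak2009]
-/

-- Sub = summit for this single-conjunct summit: the duplicate namespace component is deliberate.
set_option linter.dupNamespace false

noncomputable section

open MeasureTheory Set Function
open Literature.Analysis Literature.Analysis.FluidPDE

namespace Summit.NavierStokesRegularity.NavierStokesRegularity.Theorems.PlaneEnergyCeilingBoundedPlanarEnergyRegularity

/-- **`BoundedPlanarEnergyRegularity` ⇐ the Morrey–Liouville statement (L_M)** (conditional proof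
of the crux item stmt-NavierStokesRegularity-16921): bounded planar energies ⇒ Clay (A), provided
every bounded ancient mild solution, jointly smooth and Oseen-mild on `(−∞,0) × ℝ³`, with the
scale-invariant Morrey bound at all radii vanishes identically.
[cite: AlbrittonBarker2019, Thm 1.1; KochNadirashviliSereginSverak2009, Lemma 6.1] -/
theorem boundedPlanarEnergyRegularity_of_liouvilleMorrey
    (hLM : ∀ v : ℝ → EuclideanSpace ℝ (Fin 3) → EuclideanSpace ℝ (Fin 3),
      IsBoundedAncientMildSolution 1 v →
      ContDiffOn ℝ (⊤ : ℕ∞) (uncurry v) (Set.Iio 0 ×ˢ Set.univ) →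
      (∀ s t : ℝ, s < t → t < 0 → ∀ x,
        v t x = UnboundedOperators.heatExtension (v s) (t - s) x - oseenDuhamel 1 s v v t x) →
      (∃ M' : ℝ, ∀ t < 0, ∀ (y : EuclideanSpace ℝ (Fin 3)) (r : ℝ), 0 < r →
        ∫ x in Metric.ball y r, ‖v t x‖ ^ 2 ≤ M' * r) →
      ∀ t < 0, ∀ x, v t x = 0) :
    Summit.NavierStokesRegularity.NavierStokesRegularity.Theses.PlaneEnergyCeiling.BoundedPlanarEnergyRegularity :=
  BoundedPlanarEnergyRegularity.boundedPlanarEnergyRegularity_of_liouville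
    (PlaneEnergyCeilingPlanarEnergyLiouville.planarEnergyLiouville_of_liouvilleMorrey hLM)

/-- **`BoundedPlanarEnergyRegularity` ⇐ no local Type I singularity** (conditional proof of the
crux item stmt-NavierStokesRegularity-16921 from the open statement
`¬ LocalTypeISingularityExists`, Albritton–Barker 2019, Thm 1.1, first bullet).
[cite: AlbrittonBarker2019, Thm 1.1] -/
theorem boundedPlanarEnergyRegularity_of_not_localTypeISingularityExists
    (h : ¬ Literature.Analysis.FluidPDE.LocalTypeISingularityExists) :
    Summit.NavierStokesRegularity.NavierStokesRegularity.Theses.PlaneEnergyCeiling.BoundedPlanarEnergyRegularity :=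
  BoundedPlanarEnergyRegularity.boundedPlanarEnergyRegularity_of_liouville
    (PlaneEnergyCeilingPlanarEnergyLiouville.planarEnergyLiouville_of_not_localTypeISingularityExists h)

end Summit.NavierStokesRegularity.NavierStokesRegularity.Theorems.PlaneEnergyCeilingBoundedPlanarEnergyRegularity

end
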